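import Literature.Barriers.NavierStokesRegularity.NavierStokesInequalityCantorGlue
import Literature.Analysis.FluidPDE.SpaceTimeCalculus
import Literature.Analysis.FluidPDE.TsaiProfileL103
import HarnessLib

/-!
# Scheffer's Cantor-set switching: measurability, energy and dissipation of the glued field

Barrier catalogue support file for `NavierStokesRegularity` (D-0021), third layer of the
decomposition of `Literature.Barriers.NavierStokesRegularity.NavierStokesInequalityNearlyOneDimSingularSet`
(Scheffer 1987 = Ożański 2020 Thm. 1.6) after `NavierStokesInequalityCantorSwitching` (block,
facts A′/B′, assembly) and `NavierStokesInequalityCantorGlue` (the glued field `glueSeq`,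
elementary clauses of A′). Towards the weak-solution property via the accepted gluing principle — Ożański 2017 (arXiv:1709.00602), (2.9) and p. 30: `∇𝔲 ∈ L²(ℝ³ × (0,∞))`,
`∫₀^∞ ‖∇𝔲‖² = Σ_j ∫_{t_j}^{t_{j+1}} ‖∇u^{(j)}‖²`; Scheffer 1987, Lemma 5.11 "`∇u` is square
integrable" — this file provides the measure-theoretic bookkeeping of the piecewise-classical
field `𝔲 = glueSeq T τ w` of a Cantor block (everything PROVED):

* `Scheffer.fderiv ℝ (glueSeq T τ w t) x = D(𝔲(t))(x)` — the classical slice gradient (the weak spatial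
  gradient of print); `(Ico (switchTime T τ j) (switchTime T τ (j + 1)) ×ˢ (univ : Set ℝ³)) = [t_j,t_{j+1}) × ℝ³`; the cover of space–time by the
  strips and the two slabs `{t < 0}`, `{t ≥ T₀}` on which `𝔲 = 0`
  (`iUnion_switchStrip_cover`);
* joint a.e.-strong measurability of `𝔲` and `∇𝔲` on `ℝ × ℝ³` (`aestronglyMeasurable_glueSeq`,
  `aestronglyMeasurable_fderiv_glueSeq`: continuous on each strip, zero elsewhere);
* Tonelli on slabs (`setLIntegral_prod_univ`) and the energy bound on time slabs
  `∫∫_{I×ℝ³} |𝔲|² ≤ C |I|` (`lintegral_slab_enorm_sq_le`);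
* the dissipation bound `∫∫_{ℝ×ℝ³} |∇𝔲|² ≤ Σ_j ∫_{t_j}^{t_{j+1}}∫|∇w j|² < ∞`
  (`lintegral_frobeniusNormSq_fderiv_glueSeq_lt_top`, (2.9));
* local integrability of `𝔲` and `∇𝔲` (using the accepted `opNorm_sq_le_frobeniusNormSq_fin3`, `‖L‖²_op ≤ |L|²_F`)
  on every compact set (`integrableOn_glueSeq`, `integrableOn_fderiv_glueSeq`), hence on
  `(0,∞) × ℝ³` (`locallyIntegrableOn_glueSeq`, `locallyIntegrableOn_fderiv_glueSeq`).

## References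

* W. S. Ożański, arXiv:1709.00602 (2017), §2 (2.8)–(2.9), §6.2 p. 30. [`Ozanski2017NSISingular`]
* V. Scheffer, Comm. Math. Phys. 110 (1987), Lemma 5.11. [`Scheffer1987`]
-/

noncomputable section

open MeasureTheory Set Function Filter Topology TopologicalSpace Metric
open Literature.MeasureTheory.Hausdorff Literature.Analysis.FluidPDE
open scoped ENNReal NNReal InnerProductSpace RealInnerProductSpace ContDiff

namespace Literature.Barriers.NavierStokesRegularity

open Scheffer

/-! ### The switching strips -/

/-- Strips are measurable. [folklore] -/
theorem measurableSet_switchStrip (T τ : ℝ) (j : ℕ) : MeasurableSet ((Ico (switchTime T τ j) (switchTime T τ (j + 1)) ×ˢ (univ : Set (EuclideanSpace ℝ (Fin 3))))) :=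
  measurableSet_Ico.prod MeasurableSet.univ

/-- Space–time is covered by `{t < 0}`, the strips, and `{t ≥ T₀}`. [folklore] -/
theorem iUnion_switchStrip_cover {T τ : ℝ} (hτ₀ : 0 < τ) (hτ₁ : τ < 1) :
    (Iio (0 : ℝ) ×ˢ (univ : Set (EuclideanSpace ℝ (Fin 3)))) ∪ ((⋃ j, (Ico (switchTime T τ j) (switchTime T τ (j + 1)) ×ˢ (univ : Set (EuclideanSpace ℝ (Fin 3))))) ∪ Ici (blowupTime T τ) ×ˢ univ)
      = univ := by
  refine eq_univ_of_forall fun z => ?_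
  rcases lt_or_ge z.1 0 with h0 | h0
  · exact Or.inl ⟨h0, mem_univ _⟩
  · rcases lt_or_ge z.1 (blowupTime T τ) with h1 | h1
    · obtain ⟨j, hj⟩ := Scheffer.exists_mem_Ico_switchTime hτ₀ hτ₁ h0 h1
      exact Or.inr (Or.inl (mem_iUnion.2 ⟨j, hj, mem_univ _⟩))
    · exact Or.inr (Or.inr ⟨h1, mem_univ _⟩)

/-- **Tonelli on a time slab**: `∫∫_{I × ℝ³} F = ∫_I ∫_{ℝ³} F` for a.e.-measurable
`F ≥ 0`. [folklore] -/
theorem setLIntegral_prod_univ (I : Set ℝ) (F : ℝ × (EuclideanSpace ℝ (Fin 3)) → ℝ≥0∞)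
    (hF : AEMeasurable F (volume.restrict (I ×ˢ (univ : Set (EuclideanSpace ℝ (Fin 3)))))) :
    ∫⁻ z in I ×ˢ (univ : Set (EuclideanSpace ℝ (Fin 3))), F z = ∫⁻ t in I, ∫⁻ x, F (t, x) := by
  have hμ : (volume : Measure (ℝ × (EuclideanSpace ℝ (Fin 3)))).restrict (I ×ˢ univ) =
      (volume.restrict I).prod (volume : Measure (EuclideanSpace ℝ (Fin 3))) := by
    rw [Measure.volume_eq_prod, Measure.restrict_prod_eq_prod_univ]
  rw [hμ] at hF ⊢
  rw [lintegral_prod _ hF]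

namespace IsNSICantorBlock

variable {T ν₀ τ : ℝ} {M : ℕ} {d : Fin M → (EuclideanSpace ℝ (Fin 3))} {G : Set (EuclideanSpace ℝ (Fin 3))} {w : ℕ → ℝ → (EuclideanSpace ℝ (Fin 3)) → (EuclideanSpace ℝ (Fin 3))}

/-! ### Measurability -/

/-- On the strip `[t_j,t_{j+1}) × ℝ³` the piece `w j` is jointly continuous. [folklore] -/
theorem continuousOn_piece_strip (h : IsNSICantorBlock T ν₀ τ M d G w) (j : ℕ) :
    ContinuousOn (uncurry (w j)) ((Ico (switchTime T τ j) (switchTime T τ (j + 1)) ×ˢ (univ : Set (EuclideanSpace ℝ (Fin 3))))) := by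
  obtain ⟨η, hη, hs⟩ := h.smooth j
  exact hs.continuousOn.mono (prod_mono (fun t ht => ⟨by linarith [ht.1], by linarith [ht.2]⟩)
    subset_rfl)

/-- On the strip `[t_j,t_{j+1}) × ℝ³` the slice gradient of the piece `w j` is jointly
continuous. [folklore] -/
theorem continuousOn_fderiv_piece_strip (h : IsNSICantorBlock T ν₀ τ M d G w) (j : ℕ) :
    ContinuousOn (uncurry fun t x => fderiv ℝ (w j t) x) ((Ico (switchTime T τ j) (switchTime T τ (j + 1)) ×ˢ (univ : Set (EuclideanSpace ℝ (Fin 3))))) := by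
  obtain ⟨η, hη, hs⟩ := h.smooth j
  exact (hs.isSmoothSpaceTimeOn_fderiv_of_isOpen isOpen_Ioo).continuousOn.mono
    (prod_mono (fun t ht => ⟨by linarith [ht.1], by linarith [ht.2]⟩) subset_rfl)

/-- On the strip `[t_j,t_{j+1}) × ℝ³` the glued field is the piece. [cite: Ozanski2017NSISingular, §6.2 (6.18)] -/
theorem glueSeq_eq_on_strip (h : IsNSICantorBlock T ν₀ τ M d G w) {j : ℕ} {z : ℝ × (EuclideanSpace ℝ (Fin 3))}
    (hz : z ∈ (Ico (switchTime T τ j) (switchTime T τ (j + 1)) ×ˢ (univ : Set (EuclideanSpace ℝ (Fin 3))))) : uncurry (glueSeq T τ w) z = uncurry (w j) z := by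
  obtain ⟨t, x⟩ := z
  simp only [uncurry_apply_pair]
  rw [glueSeq_eq_of_mem h.T_pos h.τ_pos w hz.1]

/-- On the strip `[t_j,t_{j+1}) × ℝ³` the slice gradient of the glued field is that of the
piece. [folklore] -/
theorem fderiv_glueSeq_eq_on_strip (h : IsNSICantorBlock T ν₀ τ M d G w) {j : ℕ} {z : ℝ × (EuclideanSpace ℝ (Fin 3))}
    (hz : z ∈ (Ico (switchTime T τ j) (switchTime T τ (j + 1)) ×ˢ (univ : Set (EuclideanSpace ℝ (Fin 3))))) :
    uncurry (fun t x => fderiv ℝ (glueSeq T τ w t) x) z = uncurry (fun t x => fderiv ℝ (w j t) x) z := by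
  obtain ⟨t, x⟩ := z
  simp only [uncurry_apply_pair]
  rw [glueSeq_eq_of_mem h.T_pos h.τ_pos w hz.1]

/-- **Joint measurability of the glued field** on `ℝ × ℝ³` (continuous on each strip, zero
elsewhere). [folklore] -/
theorem aestronglyMeasurable_glueSeq (h : IsNSICantorBlock T ν₀ τ M d G w) :
    AEStronglyMeasurable (uncurry (glueSeq T τ w)) (volume : Measure (ℝ × (EuclideanSpace ℝ (Fin 3)))) := by
  rw [← Measure.restrict_univ (μ := (volume : Measure (ℝ × (EuclideanSpace ℝ (Fin 3))))),
    ← iUnion_switchStrip_cover (T := T) h.τ_pos h.τ_lt_one]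
  have hzero : ∀ S : Set ℝ, MeasurableSet S → S ⊆ Iio (0 : ℝ) ∪ Ici (blowupTime T τ) →
      AEStronglyMeasurable (uncurry (glueSeq T τ w))
        ((volume : Measure (ℝ × (EuclideanSpace ℝ (Fin 3)))).restrict (S ×ˢ univ)) := fun S hS hsub => by
    refine (aestronglyMeasurable_const (b := (0 : (EuclideanSpace ℝ (Fin 3))))).congr ?_
    refine (ae_restrict_mem (hS.prod MeasurableSet.univ)).mono ?_
    rintro ⟨t, x⟩ ⟨ht, -⟩
    simp only [uncurry_apply_pair]
    rw [glueSeq_eq_zero_of_mem h.T_pos h.τ_pos h.τ_lt_one w (hsub ht)]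
    rfl
  refine aestronglyMeasurable_union_iff.2 ⟨hzero _ measurableSet_Iio subset_union_left,
    aestronglyMeasurable_union_iff.2 ⟨aestronglyMeasurable_iUnion_iff.2 fun j => ?_,
      hzero _ measurableSet_Ici subset_union_right⟩⟩
  refine ((h.continuousOn_piece_strip j).aestronglyMeasurable
    (measurableSet_switchStrip T τ j)).congr ?_
  refine (ae_restrict_mem (measurableSet_switchStrip T τ j)).mono fun z hz => ?_
  exact (h.glueSeq_eq_on_strip hz).symm

/-- **Joint measurability of the slice gradient** on `ℝ × ℝ³`. [folklore] -/
theorem aestronglyMeasurable_fderiv_glueSeq (h : IsNSICantorBlock T ν₀ τ M d G w) :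
    AEStronglyMeasurable (uncurry (fun t x => fderiv ℝ (glueSeq T τ w t) x)) (volume : Measure (ℝ × (EuclideanSpace ℝ (Fin 3)))) := by
  rw [← Measure.restrict_univ (μ := (volume : Measure (ℝ × (EuclideanSpace ℝ (Fin 3))))),
    ← iUnion_switchStrip_cover (T := T) h.τ_pos h.τ_lt_one]
  have hzero : ∀ S : Set ℝ, MeasurableSet S → S ⊆ Iio (0 : ℝ) ∪ Ici (blowupTime T τ) →
      AEStronglyMeasurable (uncurry (fun t x => fderiv ℝ (glueSeq T τ w t) x))
        ((volume : Measure (ℝ × (EuclideanSpace ℝ (Fin 3)))).restrict (S ×ˢ univ)) := fun S hS hsub => by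
    refine (aestronglyMeasurable_const (b := (0 : (EuclideanSpace ℝ (Fin 3)) →L[ℝ] (EuclideanSpace ℝ (Fin 3))))).congr ?_
    refine (ae_restrict_mem (hS.prod MeasurableSet.univ)).mono ?_
    rintro ⟨t, x⟩ ⟨ht, -⟩
    simp only [uncurry_apply_pair]
    rw [glueSeq_eq_zero_of_mem h.T_pos h.τ_pos h.τ_lt_one w (hsub ht)]
    simp
  refine aestronglyMeasurable_union_iff.2 ⟨hzero _ measurableSet_Iio subset_union_left,
    aestronglyMeasurable_union_iff.2 ⟨aestronglyMeasurable_iUnion_iff.2 fun j => ?_,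
      hzero _ measurableSet_Ici subset_union_right⟩⟩
  refine ((h.continuousOn_fderiv_piece_strip j).aestronglyMeasurable
    (measurableSet_switchStrip T τ j)).congr ?_
  refine (ae_restrict_mem (measurableSet_switchStrip T τ j)).mono fun z hz => ?_
  exact (h.fderiv_glueSeq_eq_on_strip hz).symm

/-! ### Energy on time slabs and the dissipation bound -/

/-- **Energy on a time slab**: `∫∫_{I × ℝ³} |𝔲|² ≤ C |I|` with the uniform energy bound `C` of
the block (`sup_t ‖𝔲(t)‖² ≤ C`, (2.8)). [cite: Ozanski2017NSISingular, §2 (2.8)] -/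
theorem lintegral_slab_enorm_sq_le (h : IsNSICantorBlock T ν₀ τ M d G w) :
    ∃ C : ℝ≥0, ∀ I : Set ℝ, MeasurableSet I →
      ∫⁻ z in I ×ˢ (univ : Set (EuclideanSpace ℝ (Fin 3))), ‖uncurry (glueSeq T τ w) z‖ₑ ^ 2 ≤ C * volume I := by
  obtain ⟨C, hC⟩ := h.exists_lintegral_glueSeq_le
  refine ⟨C, fun I hI => ?_⟩
  have hF : AEMeasurable (fun z : ℝ × (EuclideanSpace ℝ (Fin 3)) => ‖uncurry (glueSeq T τ w) z‖ₑ ^ 2)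
      (volume.restrict (I ×ˢ (univ : Set (EuclideanSpace ℝ (Fin 3))))) :=
    (h.aestronglyMeasurable_glueSeq.aemeasurable.enorm.pow_const 2).restrict
  rw [setLIntegral_prod_univ I _ hF]
  calc ∫⁻ t in I, ∫⁻ x, ‖uncurry (glueSeq T τ w) (t, x)‖ₑ ^ 2
      ≤ ∫⁻ _ in I, (C : ℝ≥0∞) := lintegral_mono fun t => hC t
    _ = C * volume I := by rw [setLIntegral_const]

/-- The dissipation of the glued field on one strip is at most that of the piece
(`∫∫_{[t_j,t_{j+1})×ℝ³} |∇𝔲|² ≤ ∫_{t_j}^{t_{j+1}} ∫ |∇ w j|²`). [cite: Ozanski2017NSISingular, §2 (2.9)] -/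
theorem lintegral_strip_frobeniusNormSq_le (h : IsNSICantorBlock T ν₀ τ M d G w) (j : ℕ) :
    ∫⁻ z in (Ico (switchTime T τ j) (switchTime T τ (j + 1)) ×ˢ (univ : Set (EuclideanSpace ℝ (Fin 3)))), ENNReal.ofReal (frobeniusNormSq (fderiv ℝ (glueSeq T τ w z.1) z.2)) ≤
      ∫⁻ t in Icc (switchTime T τ j) (switchTime T τ (j + 1)),
        ∫⁻ x, ENNReal.ofReal (frobeniusNormSq (fderiv ℝ (w j t) x)) := by
  set Fj : ℝ × (EuclideanSpace ℝ (Fin 3)) → ℝ≥0∞ := fun z => ENNReal.ofReal (frobeniusNormSq (fderiv ℝ (w j z.1) z.2))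
    with hFj
  have hcongr : ∫⁻ z in (Ico (switchTime T τ j) (switchTime T τ (j + 1)) ×ˢ (univ : Set (EuclideanSpace ℝ (Fin 3)))),
      ENNReal.ofReal (frobeniusNormSq (fderiv ℝ (glueSeq T τ w z.1) z.2)) =
      ∫⁻ z in (Ico (switchTime T τ j) (switchTime T τ (j + 1)) ×ˢ (univ : Set (EuclideanSpace ℝ (Fin 3)))), Fj z := by
    refine setLIntegral_congr_fun (measurableSet_switchStrip T τ j) fun z hz => ?_
    have := h.fderiv_glueSeq_eq_on_strip hz
    simp only [uncurry] at this
    rw [hFj, this]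
  have hmeas : AEMeasurable Fj (volume.restrict ((Ico (switchTime T τ j) (switchTime T τ (j + 1)) ×ˢ (univ : Set (EuclideanSpace ℝ (Fin 3)))))) := by
    have hc : ContinuousOn (fun z : ℝ × (EuclideanSpace ℝ (Fin 3)) => frobeniusNormSq (fderiv ℝ (w j z.1) z.2))
        ((Ico (switchTime T τ j) (switchTime T τ (j + 1)) ×ˢ (univ : Set (EuclideanSpace ℝ (Fin 3))))) :=
      (by unfold frobeniusNormSq; exact continuous_finsetSum _ fun i _ => ((ContinuousLinearMap.apply ℝ (EuclideanSpace ℝ (Fin 3)) (stdOrthonormalBasis ℝ (EuclideanSpace ℝ (Fin 3)) i)).continuous).norm.pow 2 : Continuous fun L : (EuclideanSpace ℝ (Fin 3)) →L[ℝ] (EuclideanSpace ℝ (Fin 3)) => frobeniusNormSq L).comp_continuousOn (h.continuousOn_fderiv_piece_strip j)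
    exact ENNReal.measurable_ofReal.comp_aemeasurable
      (hc.aemeasurable (measurableSet_switchStrip T τ j))
  rw [hcongr, setLIntegral_prod_univ _ Fj hmeas]
  exact lintegral_mono_set Ico_subset_Icc_self

/-- **The dissipation bound** ((2.9); Scheffer 1987, Lemma 5.11 "`∇u` is square integrable"):
`∫∫_{ℝ × ℝ³} |∇𝔲|² ≤ Σ_j ∫_{t_j}^{t_{j+1}} ∫ |∇ w j|² < ∞`.
[cite: Ozanski2017NSISingular, §2 (2.9)] [cite: Scheffer1987, Lemma 5.11] -/
theorem lintegral_frobeniusNormSq_fderiv_glueSeq_lt_top (h : IsNSICantorBlock T ν₀ τ M d G w) :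
    ∫⁻ z : ℝ × (EuclideanSpace ℝ (Fin 3)), ENNReal.ofReal (frobeniusNormSq (fderiv ℝ (glueSeq T τ w z.1) z.2)) < ⊤ := by
  set F : ℝ × (EuclideanSpace ℝ (Fin 3)) → ℝ≥0∞ := fun z => ENNReal.ofReal (frobeniusNormSq (fderiv ℝ (glueSeq T τ w z.1) z.2))
    with hF
  have hzero : ∀ S : Set ℝ, MeasurableSet S → S ⊆ Iio (0 : ℝ) ∪ Ici (blowupTime T τ) →
      ∫⁻ z in S ×ˢ (univ : Set (EuclideanSpace ℝ (Fin 3))), F z = 0 := fun S hS hsub => by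
    refine (setLIntegral_congr_fun (hS.prod MeasurableSet.univ) fun z hz => ?_).trans
      (lintegral_zero)
    rw [hF]
    simp only
    rw [glueSeq_eq_zero_of_mem h.T_pos h.τ_pos h.τ_lt_one w (hsub hz.1)]
    simp [frobeniusNormSq_zero]
  have hcover := iUnion_switchStrip_cover (T := T) h.τ_pos h.τ_lt_one
  calc ∫⁻ z, F z = ∫⁻ z in (Iio (0 : ℝ) ×ˢ (univ : Set (EuclideanSpace ℝ (Fin 3)))) ∪
        ((⋃ j, (Ico (switchTime T τ j) (switchTime T τ (j + 1)) ×ˢ (univ : Set (EuclideanSpace ℝ (Fin 3))))) ∪ Ici (blowupTime T τ) ×ˢ univ), F z := by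
          rw [hcover, Measure.restrict_univ]
    _ ≤ (∫⁻ z in Iio (0 : ℝ) ×ˢ (univ : Set (EuclideanSpace ℝ (Fin 3))), F z) +
          ∫⁻ z in (⋃ j, (Ico (switchTime T τ j) (switchTime T τ (j + 1)) ×ˢ (univ : Set (EuclideanSpace ℝ (Fin 3))))) ∪ Ici (blowupTime T τ) ×ˢ univ, F z :=
        lintegral_union_le _ _ _
    _ ≤ (∫⁻ z in Iio (0 : ℝ) ×ˢ (univ : Set (EuclideanSpace ℝ (Fin 3))), F z) +
          ((∫⁻ z in ⋃ j, (Ico (switchTime T τ j) (switchTime T τ (j + 1)) ×ˢ (univ : Set (EuclideanSpace ℝ (Fin 3)))), F z) + ∫⁻ z in Ici (blowupTime T τ) ×ˢ univ, F z) :=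
        add_le_add le_rfl (lintegral_union_le _ _ _)
    _ = ∫⁻ z in ⋃ j, (Ico (switchTime T τ j) (switchTime T τ (j + 1)) ×ˢ (univ : Set (EuclideanSpace ℝ (Fin 3)))), F z := by
        rw [hzero _ measurableSet_Iio subset_union_left,
          hzero _ measurableSet_Ici subset_union_right, zero_add, add_zero]
    _ ≤ ∑' j, ∫⁻ z in (Ico (switchTime T τ j) (switchTime T τ (j + 1)) ×ˢ (univ : Set (EuclideanSpace ℝ (Fin 3)))), F z := lintegral_iUnion_le _ _
    _ ≤ ∑' j, ∫⁻ t in Icc (switchTime T τ j) (switchTime T τ (j + 1)),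
          ∫⁻ x, ENNReal.ofReal (frobeniusNormSq (fderiv ℝ (w j t) x)) :=
        ENNReal.tsum_le_tsum fun j => h.lintegral_strip_frobeniusNormSq_le j
    _ < ⊤ := h.dissipation

/-! ### Local integrability -/

/-- **`𝔲` is integrable on every compact set** (it is `L²` on bounded time slabs of `ℝ × ℝ³`
intersected with balls, which have finite measure). [folklore] -/
theorem integrableOn_glueSeq (h : IsNSICantorBlock T ν₀ τ M d G w) {K : Set (ℝ × (EuclideanSpace ℝ (Fin 3)))}
    (hK : IsCompact K) : IntegrableOn (uncurry (glueSeq T τ w)) K volume := by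
  obtain ⟨R, hR⟩ := hK.isBounded.subset_closedBall (0 : ℝ × (EuclideanSpace ℝ (Fin 3)))
  rw [show (0 : ℝ × (EuclideanSpace ℝ (Fin 3))) = ((0 : ℝ), (0 : (EuclideanSpace ℝ (Fin 3)))) from rfl, ← closedBall_prod_same] at hR
  set B : Set (ℝ × (EuclideanSpace ℝ (Fin 3))) := closedBall (0 : ℝ) R ×ˢ closedBall (0 : (EuclideanSpace ℝ (Fin 3))) R with hB
  have hBm : MeasurableSet B := measurableSet_closedBall.prod measurableSet_closedBall
  have hBfin : volume B < ⊤ := by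
    rw [hB, Measure.volume_eq_prod, Measure.prod_prod]
    exact ENNReal.mul_lt_top measure_closedBall_lt_top measure_closedBall_lt_top
  haveI : IsFiniteMeasure ((volume : Measure (ℝ × (EuclideanSpace ℝ (Fin 3)))).restrict B) :=
    isFiniteMeasure_restrict.2 hBfin.ne
  obtain ⟨C, hC⟩ := h.lintegral_slab_enorm_sq_le
  have hL2 : MemLp (uncurry (glueSeq T τ w)) 2 ((volume : Measure (ℝ × (EuclideanSpace ℝ (Fin 3)))).restrict B) := by
    refine ⟨h.aestronglyMeasurable_glueSeq.restrict, ?_⟩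
    rw [eLpNorm_lt_top_iff_lintegral_rpow_enorm_lt_top two_ne_zero ENNReal.ofNat_ne_top]
    simp only [ENNReal.toReal_ofNat, ENNReal.rpow_ofNat]
    calc ∫⁻ z in B, ‖uncurry (glueSeq T τ w) z‖ₑ ^ 2
        ≤ ∫⁻ z in closedBall (0 : ℝ) R ×ˢ (univ : Set (EuclideanSpace ℝ (Fin 3))), ‖uncurry (glueSeq T τ w) z‖ₑ ^ 2 :=
          lintegral_mono_set (prod_mono subset_rfl (subset_univ _))
      _ ≤ C * volume (closedBall (0 : ℝ) R) := hC _ measurableSet_closedBall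
      _ < ⊤ := ENNReal.mul_lt_top ENNReal.coe_lt_top measure_closedBall_lt_top
  have hint : IntegrableOn (uncurry (glueSeq T τ w)) B volume := MemLp.integrable one_le_two hL2
  exact hint.mono_set hR

/-- **`∇𝔲` is integrable on every compact set** (it is `L²(ℝ × ℝ³)`, `‖·‖_op ≤ |·|_F`).
[folklore] -/
theorem integrableOn_fderiv_glueSeq (h : IsNSICantorBlock T ν₀ τ M d G w) {K : Set (ℝ × (EuclideanSpace ℝ (Fin 3)))}
    (hK : IsCompact K) : IntegrableOn (uncurry (fun t x => fderiv ℝ (glueSeq T τ w t) x)) K volume := by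
  have hKfin : volume K < ⊤ := hK.measure_lt_top
  haveI : IsFiniteMeasure ((volume : Measure (ℝ × (EuclideanSpace ℝ (Fin 3)))).restrict K) :=
    isFiniteMeasure_restrict.2 hKfin.ne
  have hL2 : MemLp (uncurry (fun t x => fderiv ℝ (glueSeq T τ w t) x)) 2 ((volume : Measure (ℝ × (EuclideanSpace ℝ (Fin 3)))).restrict K) := by
    refine ⟨h.aestronglyMeasurable_fderiv_glueSeq.restrict, ?_⟩
    rw [eLpNorm_lt_top_iff_lintegral_rpow_enorm_lt_top two_ne_zero ENNReal.ofNat_ne_top]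
    simp only [ENNReal.toReal_ofNat, ENNReal.rpow_ofNat]
    calc ∫⁻ z in K, ‖uncurry (fun t x => fderiv ℝ (glueSeq T τ w t) x) z‖ₑ ^ 2
        ≤ ∫⁻ z in K, ENNReal.ofReal (frobeniusNormSq (fderiv ℝ (glueSeq T τ w z.1) z.2)) :=
          lintegral_mono fun z => (by rw [← ofReal_norm, ← ENNReal.ofReal_pow (norm_nonneg _)]; exact ENNReal.ofReal_le_ofReal (opNorm_sq_le_frobeniusNormSq_fin3 _))
      _ ≤ ∫⁻ z : ℝ × (EuclideanSpace ℝ (Fin 3)), ENNReal.ofReal (frobeniusNormSq (fderiv ℝ (glueSeq T τ w z.1) z.2)) :=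
          lintegral_mono' Measure.restrict_le_self le_rfl
      _ < ⊤ := h.lintegral_frobeniusNormSq_fderiv_glueSeq_lt_top
  exact MemLp.integrable one_le_two hL2

/-- `𝔲` is locally integrable on `(0,∞) × ℝ³` (indeed on `ℝ × ℝ³`). [folklore] -/
theorem locallyIntegrableOn_glueSeq (h : IsNSICantorBlock T ν₀ τ M d G w) :
    LocallyIntegrableOn (uncurry (glueSeq T τ w))
      ((positiveTimes : Opens (ℝ × (EuclideanSpace ℝ (Fin 3)))) : Set (ℝ × (EuclideanSpace ℝ (Fin 3)))) volume :=
  (locallyIntegrable_iff.2 fun _ hK => h.integrableOn_glueSeq hK).locallyIntegrableOn _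

/-- `∇𝔲` is locally integrable on `(0,∞) × ℝ³` (indeed on `ℝ × ℝ³`). [folklore] -/
theorem locallyIntegrableOn_fderiv_glueSeq (h : IsNSICantorBlock T ν₀ τ M d G w) :
    LocallyIntegrableOn (uncurry (fun t x => fderiv ℝ (glueSeq T τ w t) x))
      ((positiveTimes : Opens (ℝ × (EuclideanSpace ℝ (Fin 3)))) : Set (ℝ × (EuclideanSpace ℝ (Fin 3)))) volume :=
  (locallyIntegrable_iff.2 fun _ hK => h.integrableOn_fderiv_glueSeq hK).locallyIntegrableOn _

end IsNSICantorBlock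

end Literature.Barriers.NavierStokesRegularity
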